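import Mathlib
import Literature.Barriers.PneNP.TSPExtensionComplexityRothvossAssembly

/-!
# Cell pnp-psdrank, route `ChebyshevTracialDesign`: RIGIDITY OF EDGE-ADDITIVE TIGHT KERNELS — a weight on the edges of `K_n`
# whose sum vanishes on every matching tight for a cut `U` is, on all perfect matchings, a multiple of the slack `cc(U,M) − 1`
# (crux `TracialDecayExp20`, stmt-PneNP-19878; eng g12, MEMO-12 §3)

For the crux the objects are kernels `S(U,M) = tr(X_U Y_M)` vanishing on the TIGHT pairs `cc(U,M) = |δ(U) ∩ M| = 1`
[cite: Rothvoss2017, §2 (PDF pp. 5–6)]. The simplest non-polynomial candidate class on the matching side is EDGE-ADDITIVE: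
`g(U,M) = Σ_{e ∈ M} a_U(e)` with an ARBITRARY dependence on the cut `U` (e.g. pure states `⟨p_U, q_M⟩` with `q_M = Σ_{e ∈ M} β_e`,
any `p_U`; lit's slack factor `cc − 1 = ⟨(1_{δ(U)}, −1), (1_M, 1)⟩` is of this form). THEOREM (`edgeSum_eq_mul_slack`): for even `n`,
a cut `U` with `3 ≤ |U| ≤ n − 3`, and any `a : Sym2 (Fin n) → ℝ`,
  `(∀ M, cc(U,M) = 1 → Σ_{e∈M} a(e) = 0)  ⟹  ∃ λ, ∀ M, Σ_{e∈M} a(e) = λ · (cc(U,M) − 1)`.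
So every edge-additive kernel vanishing on the tight pairs of `U` IS a multiple of the slack row of `U`: its square has level
profile `λ_U² (c − 1)²` (a DOUBLE zero at the tight level), which every exact design of degree `≥ 2` prices at `−λ_U² ≤ 0` — the class is
immune, for every dimension and with no symmetry assumption on the cut side (MEMO-11 §5(c) proved the scalar product-form case on paper).
Proof (elementary, self-contained): glue tight matchings `{uv} ∪ M₁ ∪ M₂` from perfect matchings `M₁` of `U ∖ {u}` and `M₂` of `Ū ∖ {v}`;
the hypothesis makes `Σ_{M₁} a` depend on `u` only (`=: α_u`), `Σ_{M₂} a` on `v` only (`=: α'_v`), forces `a(uv) = −α_u − α'_v` on crossing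
pairs and — comparing `{ij} ∪ N` with `{uj} ∪ N` for a perfect matching `N` of `U ∖ {u,i,j}` — `a(ij) = β − α_i − α_j` inside `U`
(resp. `β' − α'_k − α'_l` inside `Ū`); hence `a(e) = θ(x) + θ(y) − [e crosses U]·(β+β')/2` with `θ = β/2 − α` on `U`, `β'/2 − α'` off `U`,
so `Σ_{e∈M} a(e) = Σ_x θ(x) − (β+β')/2 · cc(U,M)` is affine in the crossing number, and one tight matching pins the constant.
[cite: Rothvoss2017, §2 (PDF pp. 5–6)]
Stature: support/instrument (finite combinatorics; a no-go for one strategy class). WHAT THIS IS NOT: nothing on general psd strategies,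
nothing on psd rank of `P_PM(K_n)`, no P-vs-NP content.
-/

set_option linter.dupNamespace false -- `Summit.PneNP.PneNP.…`: summit = sub-problem (D-0017)

noncomputable section

namespace Summit.PneNP.PneNP.Theorems.ChebyshevTracialDesignEdgeAdditiveRigidity

open Finset Literature.Barriers.PneNP Literature.Combinatorics.SimpleGraph.CycleSpace

variable {n : ℕ}

/-! ### §1 Crossing pairs -/

/-- A pair inside a subset of `U` does not cross `U`. -/
theorem not_crosses_of_mem_sym2 {S U : Finset (Fin n)} (hS : S ⊆ U) {e : Sym2 (Fin n)} (he : e ∈ S.sym2) :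
    ¬ Crosses U e := by
  induction e using Sym2.ind with
  | h x y =>
    rw [Finset.mk_mem_sym2_iff] at he
    rw [crosses_mk]
    have hx := hS he.1; have hy := hS he.2
    tauto

/-- A pair inside a subset of `Uᶜ` does not cross `U`. -/
theorem not_crosses_of_mem_sym2_compl {S U : Finset (Fin n)} (hS : S ⊆ Uᶜ) {e : Sym2 (Fin n)} (he : e ∈ S.sym2) :
    ¬ Crosses U e := by
  induction e using Sym2.ind with
  | h x y =>
    rw [Finset.mk_mem_sym2_iff] at he
    rw [crosses_mk]
    have hx := Finset.mem_compl.1 (hS he.1); have hy := Finset.mem_compl.1 (hS he.2)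
    tauto

/-- A pair with one end in `U` and one outside crosses `U`. -/
theorem crosses_of_mem_of_not_mem {U : Finset (Fin n)} {u v : Fin n} (hu : u ∈ U) (hv : v ∉ U) :
    Crosses U s(u, v) := by
  rw [crosses_mk]; exact Or.inl ⟨hu, hv⟩

/-! ### §2 Gluing a tight matching `{uv} ∪ M₁ ∪ M₂` -/

/-- The vertex decomposition `univ = {u, v} ∪ (U ∖ u) ∪ (Uᶜ ∖ v)`. -/
theorem univ_eq_glue (U : Finset (Fin n)) (u v : Fin n) :
    (univ : Finset (Fin n)) = ({u, v} ∪ U.erase u) ∪ Uᶜ.erase v := by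
  ext x
  simp only [mem_univ, mem_union, mem_insert, mem_singleton, mem_erase, mem_compl, true_iff]
  by_cases hxu : x = u
  · exact Or.inl (Or.inl (Or.inl hxu))
  by_cases hxv : x = v
  · exact Or.inl (Or.inl (Or.inr hxv))
  by_cases hxU : x ∈ U
  · exact Or.inl (Or.inr ⟨hxu, hxU⟩)
  · exact Or.inr ⟨hxv, hxU⟩

/-- `{u, v}` is disjoint from `U ∖ u` (for `v ∉ U`). -/
theorem disjoint_pair_erase {U : Finset (Fin n)} {u v : Fin n} (hv : v ∉ U) :
    Disjoint ({u, v} : Finset (Fin n)) (U.erase u) := by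
  rw [disjoint_left]
  intro x hx hx'
  simp only [mem_insert, mem_singleton] at hx
  rw [mem_erase] at hx'
  rcases hx with rfl | rfl
  · exact hx'.1 rfl
  · exact hv hx'.2

/-- `{u, v} ∪ (U ∖ u)` is disjoint from `Uᶜ ∖ v` (for `u ∈ U`). -/
theorem disjoint_glue_left {U : Finset (Fin n)} {u v : Fin n} (hu : u ∈ U) :
    Disjoint (({u, v} : Finset (Fin n)) ∪ U.erase u) (Uᶜ.erase v) := by
  rw [disjoint_left]
  intro x hx hx'
  simp only [mem_union, mem_insert, mem_singleton, mem_erase, mem_compl] at hx hx'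
  rcases hx with (rfl | rfl) | ⟨-, hxU⟩
  · exact hx'.2 hu
  · exact hx'.1 rfl
  · exact hx'.2 hxU

/-- **Gluing**: a crossing pair `uv` together with perfect matchings of `U ∖ u` and `Uᶜ ∖ v` is a perfect matching of `K_n`. -/
theorem isPMOn_glue {U : Finset (Fin n)} {u v : Fin n} (hu : u ∈ U) (hv : v ∉ U) {M₁ M₂ : Finset (Sym2 (Fin n))}
    (h₁ : IsPMOn (U.erase u) M₁) (h₂ : IsPMOn (Uᶜ.erase v) M₂) :
    IsPMOn (univ : Finset (Fin n)) (({s(u, v)} ∪ M₁) ∪ M₂) := by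
  have huv : u ≠ v := fun h => hv (h ▸ hu)
  rw [univ_eq_glue U u v]
  exact ((IsPMOn.pair huv).union h₁ (disjoint_pair_erase hv)).union h₂ (disjoint_glue_left hu)

/-- The glued matching has exactly one crossing edge. -/
theorem card_filter_crosses_glue {U : Finset (Fin n)} {u v : Fin n} (hu : u ∈ U) (hv : v ∉ U)
    {M₁ M₂ : Finset (Sym2 (Fin n))} (h₁ : IsPMOn (U.erase u) M₁) (h₂ : IsPMOn (Uᶜ.erase v) M₂) :
    ((({s(u, v)} ∪ M₁) ∪ M₂).filter (Crosses U)).card = 1 := by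
  have hf1 : M₁.filter (Crosses U) = ∅ :=
    filter_eq_empty_iff.2 fun e he => not_crosses_of_mem_sym2 (erase_subset u U) (h₁.subset_sym2 he)
  have hf2 : M₂.filter (Crosses U) = ∅ :=
    filter_eq_empty_iff.2 fun e he =>
      not_crosses_of_mem_sym2_compl ((erase_subset v Uᶜ)) (h₂.subset_sym2 he)
  have hf0 : ({s(u, v)} : Finset (Sym2 (Fin n))).filter (Crosses U) = {s(u, v)} :=
    filter_true_of_mem fun e he => by rw [mem_singleton] at he; rw [he]; exact crosses_of_mem_of_not_mem hu hv
  rw [filter_union, filter_union, hf0, hf1, hf2, union_empty, union_empty, card_singleton]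

/-- The three parts of the glued matching are pairwise disjoint edge sets, so sums split. -/
theorem sum_glue {U : Finset (Fin n)} {u v : Fin n} (hu : u ∈ U) (hv : v ∉ U)
    {M₁ M₂ : Finset (Sym2 (Fin n))} (h₁ : IsPMOn (U.erase u) M₁) (h₂ : IsPMOn (Uᶜ.erase v) M₂)
    (a : Sym2 (Fin n) → ℝ) :
    ∑ e ∈ ({s(u, v)} ∪ M₁) ∪ M₂, a e = a s(u, v) + ∑ e ∈ M₁, a e + ∑ e ∈ M₂, a e := by
  have huv : u ≠ v := fun h => hv (h ▸ hu)
  have hd01 : Disjoint ({s(u, v)} : Finset (Sym2 (Fin n))) M₁ :=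
    (IsPMOn.pair huv).disjoint_of_disjoint h₁ (disjoint_pair_erase hv)
  have hd12 : Disjoint (({s(u, v)} : Finset (Sym2 (Fin n))) ∪ M₁) M₂ :=
    ((IsPMOn.pair huv).union h₁ (disjoint_pair_erase hv)).disjoint_of_disjoint h₂ (disjoint_glue_left hu)
  rw [sum_union hd12, sum_union hd01, sum_singleton]

/-- The glued matching, as a perfect matching of `K_n`, is tight for `U`. -/
theorem cc_glue (U : OddSet n) {u v : Fin n} (hu : u ∈ U.1) (hv : v ∉ U.1) {M₁ M₂ : Finset (Sym2 (Fin n))}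
    (h₁ : IsPMOn (U.1.erase u) M₁) (h₂ : IsPMOn (U.1ᶜ.erase v) M₂) :
    cc U ⟨({s(u, v)} ∪ M₁) ∪ M₂, isPMOn_glue hu hv h₁ h₂⟩ = 1 :=
  card_filter_crosses_glue hu hv h₁ h₂

/-! ### §3 Perfect matchings of `S ∖ {u}` with a common sum pin the pair weights inside `S` -/

/-- Removing three distinct points from a set of odd size `≥ 3` leaves a set of even size. -/
theorem even_card_erase_three {S : Finset (Fin n)} (hodd : Odd S.card) {u i j : Fin n}
    (hu : u ∈ S) (hi : i ∈ S) (hj : j ∈ S) (hui : u ≠ i) (huj : u ≠ j) (hij : i ≠ j) :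
    Even (((S.erase u).erase i).erase j).card := by
  have hi' : i ∈ S.erase u := mem_erase.2 ⟨hui.symm, hi⟩
  have hj' : j ∈ (S.erase u).erase i := mem_erase.2 ⟨hij.symm, mem_erase.2 ⟨huj.symm, hj⟩⟩
  rw [card_erase_of_mem hj', card_erase_of_mem hi', card_erase_of_mem hu]
  have h3 : 3 ≤ S.card := by
    have : ({u, i, j} : Finset (Fin n)) ⊆ S := by
      intro x hx; simp only [mem_insert, mem_singleton] at hx; rcases hx with rfl | rfl | rfl <;> assumption
    have hc : ({u, i, j} : Finset (Fin n)).card = 3 := by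
      rw [card_insert_of_notMem, card_pair hij]; simp [hui, huj]
    exact hc ▸ card_le_card this
  obtain ⟨k, hk⟩ := hodd
  exact ⟨k - 1, by omega⟩

/-- `S ∖ u = {i, j} ∪ (S ∖ {u, i, j})` for distinct `u, i, j ∈ S`. -/
theorem erase_eq_pair_union {S : Finset (Fin n)} {u i j : Fin n} (hi : i ∈ S) (hj : j ∈ S)
    (hui : u ≠ i) (huj : u ≠ j) (hij : i ≠ j) :
    S.erase u = {i, j} ∪ ((S.erase u).erase i).erase j := by
  ext x
  simp only [mem_erase, mem_union, mem_insert, mem_singleton]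
  constructor
  · rintro ⟨hxu, hxS⟩
    by_cases hxi : x = i
    · exact Or.inl (Or.inl hxi)
    by_cases hxj : x = j
    · exact Or.inl (Or.inr hxj)
    · exact Or.inr ⟨hxj, hxi, hxu, hxS⟩
  · rintro ((rfl | rfl) | ⟨-, -, hxu, hxS⟩)
    · exact ⟨hui.symm, hi⟩
    · exact ⟨huj.symm, hj⟩
    · exact ⟨hxu, hxS⟩

/-- `{i, j}` is disjoint from `S ∖ {u, i, j}`. -/
theorem disjoint_pair_erase_three {S : Finset (Fin n)} (u i j : Fin n) :
    Disjoint ({i, j} : Finset (Fin n)) (((S.erase u).erase i).erase j) := by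
  rw [disjoint_left]
  intro x hx hx'
  simp only [mem_insert, mem_singleton] at hx
  simp only [mem_erase] at hx'
  rcases hx with rfl | rfl
  · exact hx'.2.1 rfl
  · exact hx'.1 rfl

/-- **Exchange step.** If for every `u ∈ S` all perfect matchings of `S ∖ u` have `a`-sum `α u`, then for distinct
`u, i, j ∈ S`: `a(ij) + α i = a(uj) + α u` (compare `{ij} ∪ N` and `{uj} ∪ N` for a perfect matching `N` of `S ∖ {u,i,j}`). -/
theorem exchange {S : Finset (Fin n)} (hodd : Odd S.card) (a : Sym2 (Fin n) → ℝ) (α : Fin n → ℝ)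
    (h : ∀ u ∈ S, ∀ N, IsPMOn (S.erase u) N → ∑ e ∈ N, a e = α u)
    {u i j : Fin n} (hu : u ∈ S) (hi : i ∈ S) (hj : j ∈ S) (hui : u ≠ i) (huj : u ≠ j) (hij : i ≠ j) :
    a s(i, j) + α i = a s(u, j) + α u := by
  set R := ((S.erase u).erase i).erase j with hR
  obtain ⟨N, hN⟩ := exists_isPMOn_of_even R.card R rfl (even_card_erase_three hodd hu hi hj hui huj hij)
  -- `{ij} ∪ N` is a perfect matching of `S ∖ u`
  have h1 : IsPMOn (S.erase u) ({s(i, j)} ∪ N) := by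
    rw [erase_eq_pair_union hi hj hui huj hij]
    exact (IsPMOn.pair hij).union hN (disjoint_pair_erase_three u i j)
  -- `{uj} ∪ N` is a perfect matching of `S ∖ i` (same remainder `R`)
  have hR' : ((S.erase i).erase u).erase j = R := by
    ext x; simp only [hR, mem_erase]; tauto
  have h2 : IsPMOn (S.erase i) ({s(u, j)} ∪ N) := by
    rw [erase_eq_pair_union hu hj hui.symm hij huj, hR']
    exact (IsPMOn.pair huj).union hN (hR' ▸ disjoint_pair_erase_three i u j)
  have hd1 : Disjoint ({s(i, j)} : Finset (Sym2 (Fin n))) N :=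
    (IsPMOn.pair hij).disjoint_of_disjoint hN (disjoint_pair_erase_three u i j)
  have hd2 : Disjoint ({s(u, j)} : Finset (Sym2 (Fin n))) N :=
    (IsPMOn.pair huj).disjoint_of_disjoint hN (hR' ▸ disjoint_pair_erase_three i u j)
  have e1 := h u hu _ h1
  have e2 := h i hi _ h2
  rw [sum_union hd1, sum_singleton] at e1
  rw [sum_union hd2, sum_singleton] at e2
  linarith

/-- **Pair weights inside `S`.** Under the hypothesis of `exchange`, with `3 ≤ |S|` odd, there is `β` with
`a(ij) = β − α i − α j` for all distinct `i, j ∈ S`. -/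
theorem pair_weight_eq {S : Finset (Fin n)} (hodd : Odd S.card) (h3 : 3 ≤ S.card) (a : Sym2 (Fin n) → ℝ)
    (α : Fin n → ℝ) (h : ∀ u ∈ S, ∀ N, IsPMOn (S.erase u) N → ∑ e ∈ N, a e = α u) :
    ∃ β : ℝ, ∀ i ∈ S, ∀ j ∈ S, i ≠ j → a s(i, j) = β - α i - α j := by
  -- `b(i,j) := a(ij) + α i + α j` satisfies `b(i,j) = b(u,j)` for `u ∉ {i,j}` and is symmetric
  set b : Fin n → Fin n → ℝ := fun i j => a s(i, j) + α i + α j with hb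
  have hsymm : ∀ i j, b i j = b j i := by
    intro i j; simp only [hb, Sym2.eq_swap]; ring
  have hexch : ∀ u ∈ S, ∀ i ∈ S, ∀ j ∈ S, u ≠ i → u ≠ j → i ≠ j → b i j = b u j := by
    intro u hu i hi j hj hui huj hij
    have := exchange hodd a α h hu hi hj hui huj hij
    simp only [hb]; linarith
  -- two distinct base points
  obtain ⟨i₀, hi₀, j₀, hj₀, hij₀⟩ : ∃ i₀ ∈ S, ∃ j₀ ∈ S, i₀ ≠ j₀ := by
    have h1 : 1 < S.card := by omega
    obtain ⟨i₀, hi₀, j₀, hj₀, hne⟩ := one_lt_card.1 h1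
    exact ⟨i₀, hi₀, j₀, hj₀, hne⟩
  refine ⟨b i₀ j₀, fun i hi j hj hij => ?_⟩
  -- `b i j = b i₀ j₀` by a short case analysis
  have key : b i j = b i₀ j₀ := by
    by_cases h1 : i₀ = i
    · subst h1
      by_cases h2 : j₀ = j
      · subst h2; rfl
      · -- b i j = b j i = b j₀ i = b i j₀
        rw [hsymm i₀ j, hexch j₀ hj₀ j hj i₀ hi h2 hij₀.symm hij.symm, hsymm]
    · by_cases h2 : i₀ = j
      · subst h2
        -- b i j = b j₀? : b i i₀ with i ≠ i₀; want b i₀ j₀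
        by_cases h3 : j₀ = i
        · subst h3; exact hsymm _ _
        · rw [hexch j₀ hj₀ i hi i₀ hi₀ h3 hij₀.symm hij, hsymm j₀ i₀]
      · -- i₀ ∉ {i, j}: b i j = b i₀ j
        rw [hexch i₀ hi₀ i hi j hj h1 h2 hij]
        by_cases h3 : j₀ = j
        · subst h3; rfl
        · -- b i₀ j = b j i₀ = b j₀ i₀ = b i₀ j₀
          by_cases h4 : j = j₀
          · subst h4; rfl
          · rw [hsymm i₀ j, hexch j₀ hj₀ j hj i₀ hi₀ (Ne.symm h4) hij₀.symm (Ne.symm h2), hsymm]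
  have : a s(i, j) = b i j - α i - α j := by simp only [hb]; ring
  rw [this, key]

/-! ### §4 Vertex sums over a perfect matching -/

/-- For a non-diagonal pair `e = {x, y}`, the symmetric pair function `θ x + θ y` (written with `Sym2.lift`) is the sum of
`θ` over the vertices of the pair. -/
theorem lift_add_eq_sum_filter (θ : Fin n → ℝ) {e : Sym2 (Fin n)} (he : ¬ e.IsDiag) :
    Sym2.lift ⟨fun x y => θ x + θ y, fun _ _ => add_comm _ _⟩ e = ∑ x ∈ univ.filter (fun x => x ∈ e), θ x := by
  induction e using Sym2.ind with
  | h x y =>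
    have hxy : x ≠ y := by rwa [Sym2.mk_isDiag_iff] at he
    have : univ.filter (fun z => z ∈ s(x, y)) = ({x, y} : Finset (Fin n)) := by
      ext z; simp [Sym2.mem_iff]
    rw [Sym2.lift_mk, this, sum_pair hxy]

/-- **A perfect matching covers every vertex once**: `Σ_{e = {x,y} ∈ M} (θ x + θ y) = Σ_x θ x`. -/
theorem sum_lift_add_eq (θ : Fin n → ℝ) (M : PMatch n) :
    ∑ e ∈ M.1, Sym2.lift ⟨fun x y => θ x + θ y, fun _ _ => add_comm _ _⟩ e = ∑ x, θ x := by
  calc ∑ e ∈ M.1, Sym2.lift ⟨fun x y => θ x + θ y, fun _ _ => add_comm _ _⟩ e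
      = ∑ e ∈ M.1, ∑ x ∈ univ.filter (fun x => x ∈ e), θ x :=
        sum_congr rfl fun e he => lift_add_eq_sum_filter θ (M.2.not_isDiag he)
    _ = ∑ e ∈ M.1, ∑ x, if x ∈ e then θ x else 0 := by
        refine sum_congr rfl fun e _ => ?_
        rw [sum_filter]
    _ = ∑ x, ∑ e ∈ M.1, if x ∈ e then θ x else 0 := sum_comm
    _ = ∑ x, θ x := by
        refine sum_congr rfl fun x _ => ?_
        rw [← sum_filter, sum_const, M.2.card_filter (mem_univ x), one_smul]

/-- The indicator sum of the crossing pairs of `M` is `cc(U,M)`. -/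
theorem sum_ite_crosses (U : OddSet n) (M : PMatch n) (κ : ℝ) :
    ∑ e ∈ M.1, (if Crosses U.1 e then κ else 0) = κ * (cc U M : ℝ) := by
  rw [← sum_filter, sum_const, nsmul_eq_mul, mul_comm]
  rfl

/-! ### §5 The rigidity theorem -/

/-- **Rigidity of edge-additive tight kernels.** For even `n`, a cut `U` with `3 ≤ |U|` and `|U| + 3 ≤ n`, and any real
weights `a` on the pairs of `K_n`: if `Σ_{e ∈ M} a(e) = 0` for every perfect matching `M` tight for `U` (`cc(U,M) = 1`), then
`Σ_{e ∈ M} a(e) = λ · (cc(U,M) − 1)` for ALL perfect matchings `M`, for one real `λ`. [cite: Rothvoss2017, §2 (PDF pp. 5–6)] -/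
theorem edgeSum_eq_mul_slack (hn : Even n) (U : OddSet n) (h3 : 3 ≤ U.1.card) (h3' : U.1.card + 3 ≤ n)
    (a : Sym2 (Fin n) → ℝ) (ha : ∀ M : PMatch n, cc U M = 1 → ∑ e ∈ M.1, a e = 0) :
    ∃ lam : ℝ, ∀ M : PMatch n, ∑ e ∈ M.1, a e = lam * ((cc U M : ℝ) - 1) := by
  obtain ⟨t, ht⟩ : ∃ t, U.1.card = t := ⟨_, rfl⟩
  have htodd : Odd t := ht ▸ U.2
  -- parity bookkeeping
  have hcU : U.1ᶜ.card = n - t := by rw [card_compl, Fintype.card_fin, ht]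
  have hcodd : Odd U.1ᶜ.card := by
    rw [hcU]; obtain ⟨k, hk⟩ := hn; obtain ⟨l, hl⟩ := htodd; exact ⟨k - l - 1, by omega⟩
  have hc3 : 3 ≤ U.1ᶜ.card := by rw [hcU]; omega
  have heU : ∀ u ∈ U.1, Even (U.1.erase u).card := by
    intro u hu; rw [card_erase_of_mem hu, ht]; obtain ⟨l, hl⟩ := htodd; exact ⟨l, by omega⟩
  have heC : ∀ v ∈ U.1ᶜ, Even (U.1ᶜ.erase v).card := by
    intro v hv; rw [card_erase_of_mem hv]; obtain ⟨l, hl⟩ := hcodd; exact ⟨l, by omega⟩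
  -- reference points and reference matchings
  obtain ⟨u₀, hu₀⟩ : U.1.Nonempty := card_pos.1 (by omega)
  obtain ⟨v₀, hv₀⟩ : U.1ᶜ.Nonempty := card_pos.1 (by omega)
  have hv₀' : v₀ ∉ U.1 := mem_compl.1 hv₀
  obtain ⟨M₁₀, hM₁₀⟩ := exists_isPMOn_of_even _ (U.1.erase u₀) rfl (heU u₀ hu₀)
  obtain ⟨M₂₀, hM₂₀⟩ := exists_isPMOn_of_even _ (U.1ᶜ.erase v₀) rfl (heC v₀ hv₀)
  -- α, α'
  set α : Fin n → ℝ := fun u => -a s(u, v₀) - ∑ e ∈ M₂₀, a e with hα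
  set α' : Fin n → ℝ := fun v => -a s(u₀, v) - ∑ e ∈ M₁₀, a e with hα'
  have hA : ∀ u ∈ U.1, ∀ N, IsPMOn (U.1.erase u) N → ∑ e ∈ N, a e = α u := by
    intro u hu N hN
    have h0 := ha ⟨_, isPMOn_glue hu hv₀' hN hM₂₀⟩ (cc_glue U hu hv₀' hN hM₂₀)
    change ∑ e ∈ ({s(u, v₀)} ∪ N) ∪ M₂₀, a e = 0 at h0
    rw [sum_glue hu hv₀' hN hM₂₀] at h0
    simp only [hα]; linarith
  have hA' : ∀ v ∈ U.1ᶜ, ∀ N, IsPMOn (U.1ᶜ.erase v) N → ∑ e ∈ N, a e = α' v := by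
    intro v hv N hN
    have hv' : v ∉ U.1 := mem_compl.1 hv
    have h0 := ha ⟨_, isPMOn_glue hu₀ hv' hM₁₀ hN⟩ (cc_glue U hu₀ hv' hM₁₀ hN)
    change ∑ e ∈ ({s(u₀, v)} ∪ M₁₀) ∪ N, a e = 0 at h0
    rw [sum_glue hu₀ hv' hM₁₀ hN] at h0
    simp only [hα']; linarith
  -- crossing pairs
  have hX : ∀ u ∈ U.1, ∀ v ∉ U.1, a s(u, v) = -α u - α' v := by
    intro u hu v hv
    have hvc : v ∈ U.1ᶜ := mem_compl.2 hv
    obtain ⟨N₁, hN₁⟩ := exists_isPMOn_of_even _ (U.1.erase u) rfl (heU u hu)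
    obtain ⟨N₂, hN₂⟩ := exists_isPMOn_of_even _ (U.1ᶜ.erase v) rfl (heC v hvc)
    have h0 := ha ⟨_, isPMOn_glue hu hv hN₁ hN₂⟩ (cc_glue U hu hv hN₁ hN₂)
    change ∑ e ∈ ({s(u, v)} ∪ N₁) ∪ N₂, a e = 0 at h0
    rw [sum_glue hu hv hN₁ hN₂, hA u hu N₁ hN₁, hA' v hvc N₂ hN₂] at h0
    linarith
  -- inside pairs
  obtain ⟨β, hβ⟩ := pair_weight_eq U.2 h3 a α hA
  obtain ⟨β', hβ'⟩ := pair_weight_eq hcodd hc3 a α' hA'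
  -- the vertex potential
  set θ : Fin n → ℝ := fun x => if x ∈ U.1 then β / 2 - α x else β' / 2 - α' x with hθ
  set κ : ℝ := (β + β') / 2 with hκ
  have hedge : ∀ M : PMatch n, ∀ e ∈ M.1, a e = Sym2.lift ⟨fun x y => θ x + θ y, fun _ _ => add_comm _ _⟩ e - (if Crosses U.1 e then κ else 0) := by
    intro M e he
    have hnd := M.2.not_isDiag he
    induction e using Sym2.ind with
    | h x y =>
      have hxy : x ≠ y := by rwa [Sym2.mk_isDiag_iff] at hnd
      rw [Sym2.lift_mk]
      by_cases hx : x ∈ U.1 <;> by_cases hy : y ∈ U.1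
      · have hc : ¬ Crosses U.1 s(x, y) := by rw [crosses_mk]; tauto
        rw [hβ x hx y hy hxy, if_neg hc]; simp only [hθ, if_pos hx, if_pos hy]; ring
      · have hc : Crosses U.1 s(x, y) := by rw [crosses_mk]; exact Or.inl ⟨hx, hy⟩
        rw [hX x hx y hy, if_pos hc]; simp only [hθ, if_pos hx, if_neg hy, hκ]; ring
      · have hc : Crosses U.1 s(x, y) := by rw [crosses_mk]; exact Or.inr ⟨hx, hy⟩
        have hyx := hX y hy x hx
        rw [Sym2.eq_swap] at hyx
        rw [hyx, if_pos hc]; simp only [hθ, if_neg hx, if_pos hy, hκ]; ring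
      · have hc : ¬ Crosses U.1 s(x, y) := by rw [crosses_mk]; tauto
        rw [hβ' x (mem_compl.2 hx) y (mem_compl.2 hy) hxy, if_neg hc]
        simp only [hθ, if_neg hx, if_neg hy]; ring
  have hsum : ∀ M : PMatch n, ∑ e ∈ M.1, a e = (∑ x, θ x) - κ * (cc U M : ℝ) := by
    intro M
    rw [sum_congr rfl (hedge M), sum_sub_distrib, sum_lift_add_eq, sum_ite_crosses]
  -- one tight matching pins the constant
  have hpin : (∑ x, θ x) = κ := by
    have h0 := ha ⟨_, isPMOn_glue hu₀ hv₀' hM₁₀ hM₂₀⟩ (cc_glue U hu₀ hv₀' hM₁₀ hM₂₀)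
    rw [hsum, cc_glue U hu₀ hv₀' hM₁₀ hM₂₀] at h0
    push_cast at h0; linarith
  refine ⟨-κ, fun M => ?_⟩
  rw [hsum M, hpin]; ring

end Summit.PneNP.PneNP.Theorems.ChebyshevTracialDesignEdgeAdditiveRigidity

end
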